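import Summits.QuantumFields.YangMills.Theorems.BalabanUVNodesN16EndUniform
import HarnessLib

/-!
# Route «BalabanUVNodes» (cluster K4 «SpineRates»), Track-A DAG node N16 = NE3 — THE CONSTANT OF RECORD: N16's `C` chosen BEFORE the leaf
# letters `(b′, c′)`, the class radius `ε`, the B8 letters `s₁, s₂`, the regularity `b` and the data set `dom` — ONE number per `(d, L, N, card n, g)`:
# `∃ r > 0, ∀ g > 0, ∃ C ≥ 0, ∀ …, N05-interface → N07-interface → NE3EnergyRateWCov d (sfClass d L N ε) L N b g C s₁ s₂ dom`

Cell `pub-ymgap`, seat `pub-ymgap-dag-n16-a` (KNIT-BY-NAME, HUMAN RULING D-0062; chair R424 venue), generation 3, file 1.  `bears_on: R4∕N16`.  Filed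
`--supports stmt-QuantumFields-19182` (`SpineGivenEndpoint`, K4).

WHY.  p410193's `BalabanUVNodesN16EndUniform.n16_of_inEdges_uniform` states THE END of record with `∃ r` FIRST but `∃ C` LAST (after `ε, s₁, b, s₂, dom` and
the two interfaces).  Cluster K4's reading `N16At c := NE3EnergyRateWCov 4 (sfClass 4 c.L c.Nper c.ε) c.L c.Nper c.b c.g c.C c.Λ₁ c.Λ₂' c.dom` (dagwriter module
`BalabanUVNodesSpineRates`, supply) has ONE constant field `c.C` for the rate-record predicate `RRec` to pin, and the consumers' energy letter `γ` (N21
`BalabanUVNodesN21SlotSupJunction.abs_slotA_sub_slotB_le_of_n16`'s `hγ3 : C·(wallConst 4 L·N²·(√g·dualC2 + 2b²·dualC1)) ≤ γ³`; N19's budget) is read off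
`C`.  Here `∃ C` sits right after `∀ g > 0`: ONE constant across the regime `0 < ε ≤ r`, `0 ≤ s₁ ≤ r`, `0 ≤ b ≤ ε∕2`, all `s₂`, all leaf letters on their
two lines, all `dom` (not before `g`: THE END's constant carries `√(d∕(g·L^{d+2}))`).

HOW (no new estimate).  THE END `NE3.PairLandauB8EndSfClassTowers.ne3EnergyRateWCov_sfClass_towers` DISPLAYS its constant
`C_END = (1 + (ν + 23√2·√(16d+1)·(1+ν)))·(4∕cΛ(CP, Λ))·((1 + √(192dL(d+#planes)))·(√(L^{d−2}) + X·b + b²·Y·√(d∕(gL^{d+2}))))`, `ν = (1+2048√(16d+1))·(2√ρ(ε)·P·s₁)`.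
Two of the k-free lines of `NE3.EndLinesNonVacuous.endLines_exists` bound it uniformly: `hρ` (`2ρ(ε)P²s₁² ≤ ½`) gives `ν ≤ 1 + 2048√(16d+1)`; `hreg₁`
(`CP·(√Λ − 1)² ≤ ¼`) gives, for `CP > 0`, `4∕cΛ = 8·card n·(1+4CP)·(1+√Λ)² ≤ 8·card n·(1+4CP)·(8 + 1∕(2CP))`; and `0 ≤ b ≤ ε∕2 ≤ ½`.  So `C_END ≤ C⋆(d, L, card n,
CP, g)` (§1 `endConst_le`) and `NE3EnergyRateWCov.mono` concludes; the owner's slice constant is POSITIVE (`CPLine_pos`), so `CP > 0` is free on the line-free road.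

CONTENT (0 `def`, 0 `sorry`; bookkeeping over landed theorems BY NAME + two real-algebra lemmas): §1 `endConst_le`, `CPLine_pos`; §2
`ne3EnergyRateWCov_sfClass_small_const` — p410193 §1 with the constant `C⋆` DISPLAYED, free of `(ε, s₁, b, s₂, dom)` (`CP > 0`); §3
`ne3EnergyRateWCov_sfClass_small_of_leafH3sup_const` — `hF5` traded for N07's interface (H3ˢᵘᵖ), same displayed constant; §4
`ne3EnergyRateWCov_sfClass_small_of_lines_const` — the owner's four k-free lines, `∃ C ≥ 0` right after `∀ g`; §5 **`n16_constant_of_record`** (`d = 4`, no numeric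
line but the two leaf lines): `∃ r > 0, ∀ g > 0, ∃ C ≥ 0, ∀ b′ c′ ε s₁ b s₂ dom, PairLandauGaugeB8Avg 4 (sfClass 4 L N ε) L N b g s₁ s₂ 1 dom → LeafH3sup 4 L N ε b′ c′ dom →
NE3EnergyRateWCov 4 (sfClass 4 L N ε) L N b g C s₁ s₂ dom` (= `YMDAG.N16 L N ε b g C s₁ s₂ dom`); p410193's form follows by `⟨C, ·⟩` — a strengthening.

HONEST FRAMING.  Binder-order bookkeeping over LANDED theorems by name; nothing of Bałaban's is asserted; the N05 interface `PairLandauGaugeB8Avg`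
([Balaban1985RegularSpaces] Thm 2 + (1.37) ∘ [Balaban1985Variational] Thm 1 TYPE at the pairs) and the N07 interface `LeafH3sup` ([Balaban1985Variational]
Thm 1 (8)+(10) TYPE) remain HYPOTHESES; **N16 ∕ NE3 is NOT discharged**; NODE 00 has not pinned NE3's carriers; count-neutral; one finite four-torus at
fixed ε — NOT ℝ⁴, NOT infinite volume, NOT OS, NOT a mass gap, NOT Clay.
-/

set_option autoImplicit false

open scoped BigOperators Matrix Matrix.Norms.L2Operator
open NormedSpace Finset

namespace Summit.QuantumFields.YangMills.BalabanUVNodes.N16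

open Literature.MathematicalPhysics.QuantumFieldTheory.Balaban1983to89
open B7Prop1Explicit B7Prop2Explicit
open T4AveragingDeficitWall (IsUnitaryCfg SmallField Plane)
open T4AveragingDeficitWallBoundary (periodBox)
open Summit.QuantumFields.BalabanUV.T4Continuum
open AveragingDeficitChartCalculus (cavg)
open AveragingDeficitMultiLevelPrep (LevelSmall)
open AveragingDeficitTwoLevelPrep (twoLevelSmall)
open MinimalActionSandwich (IsMinimiser)
open MinimalActionRate (Regular sfClass)
open BlockAverageCurrent (curConst curConst_nonneg)
open NE3EnergyWeightedCovShape (NE3EnergyRateWCov)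
open NE3SlicePoincareShape (SlicePoincare)
open NE3EnergyRateWSupOfSlicePoincare (cLambda cLambda_pos)
open NE3QbarIterCovLiftPrep (cruxC liftC liftC_nonneg)
open NE3RightInverseSolveLetters (thetaLoc cruxC_nonneg)
open NE3RightInverseSupLetters (frameC)
open NE3SlicePoincareBudgetLine (CPLine ShLine SmallYLine ALine KhLine cfTop lrTop qTop gTop bhTop)
open NE3CovariantLineSumsL2 (C2sq)
open NE3CovariantLineSumsL2Tower (rho)
open NE3.PairLandauB8Avg (PairLandauGaugeB8Avg slicB8)
open NE3.LandauProjectionSupShape (LandauCorrectionSupB8)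
open NE3.LeafIndexSockets (LeafH3sup)
open NE3.PairLandauB8EndSfClassTowers (ne3EnergyRateWCov_sfClass_towers)
open NE3.EndLinesNonVacuous (endLines_exists)
open NE3.PairLandauB8EndSupFacts (cruxC_eps_le_half supFacts_const_le)
open NE3.SupRegularityCurvedUniform (one_le_frameC_add)
open NE3.PairLandauB8EndSfClassH3sup (hF5_of_leafH3sup)
open NE3.SlicePoincareCoulombN (CPLine_nonneg)
open NE3.PairLandauB8EndSfClassHP (slicePoincare_slicB8_cavg_of_regular ownerLines_exist)

noncomputable section

variable {d : ℕ} {n : Type*} [Fintype n] [DecidableEq n]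

/-! ## §1 Real algebra: the uniform majorant of THE END's displayed constant; positivity of the owner's slice constant -/

omit [DecidableEq n] in
/-- **THE UNIFORM MAJORANT OF THE END's CONSTANT.**  THE END's displayed constant has the shape
`(1 + ((1+2048S)·V + 23·T·S·(1 + (1+2048S)·V))) · (4∕cΛ(CP, Λ)) · (K·(B₀ + X·b + b²·Y·G))` with `V = 2√ρ·P·s₁` (`S = √(16d+1)`, `T = √2`, `ρ = ρ(ε)`,
`K, B₀, X, Y, G ≥ 0` closed terms).  Under the two k-free lines `2ρP²s₁² ≤ ½` (so `V ≤ 1`) and `CP·(√Λ − 1)² ≤ ¼` with `CP > 0` (so `(1+√Λ)² ≤ 8 + 1∕(2CP)`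
and `4∕cΛ = 8·card n·(1+4CP)·(1+√Λ)²`), and `0 ≤ b ≤ ½`, it is at most
`(1 + ((1+2048S) + 23·T·S·(1 + (1+2048S)))) · (8·card n·(1+4CP)·(8 + 1∕(2CP))) · (K·(B₀ + X∕2 + Y·G∕4))` — free of `(ε, s₁, b, P, Λ)`. [folklore] -/
theorem endConst_le [Nonempty n] {S T RX P s₁ CP Λ K B₀ X Y G b : ℝ} (hS : 0 ≤ S) (hT : 0 ≤ T) (hRX : 0 ≤ RX) (hP : 0 ≤ P)
    (hs₁ : 0 ≤ s₁) (hCP : 0 < CP) (hK : 0 ≤ K) (hB₀ : 0 ≤ B₀) (hX : 0 ≤ X) (hY : 0 ≤ Y) (hG : 0 ≤ G) (hb : 0 ≤ b) (hb2 : b ≤ 1 / 2)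
    (hρ : 2 * RX * P ^ 2 * s₁ ^ 2 ≤ 1 / 2) (hreg : CP * (Real.sqrt Λ - 1) ^ 2 ≤ 1 / 4) :
    (1 + ((1 + 2048 * S) * (2 * Real.sqrt RX * P * s₁) + 23 * T * S * (1 + (1 + 2048 * S) * (2 * Real.sqrt RX * P * s₁))))
        * (4 / cLambda n CP Λ) * (K * (B₀ + X * b + b ^ 2 * Y * G))
      ≤ (1 + ((1 + 2048 * S) + 23 * T * S * (1 + (1 + 2048 * S))))
        * (8 * (Fintype.card n : ℝ) * (1 + 4 * CP) * (8 + 1 / (2 * CP))) * (K * (B₀ + X / 2 + Y * G / 4)) := by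
  have hcard : (0 : ℝ) < (Fintype.card n : ℝ) := by exact_mod_cast Fintype.card_pos
  set V : ℝ := 2 * Real.sqrt RX * P * s₁ with hVdef; have hV0 : 0 ≤ V := by rw [hVdef]; positivity
  have hV1 : V ≤ 1 := by
    have hsq : V ^ 2 ≤ 1 := by
      have e : V ^ 2 = 2 * (2 * RX * P ^ 2 * s₁ ^ 2) := by
        rw [hVdef]; have := Real.sq_sqrt hRX; ring_nf; rw [this]; ring
      rw [e]; linarith
    exact (pow_le_one_iff_of_nonneg hV0 two_ne_zero).1 hsq
  have hU0 : 0 ≤ 1 + 2048 * S := by positivity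
  have hA1 : 1 + ((1 + 2048 * S) * V + 23 * T * S * (1 + (1 + 2048 * S) * V))
      ≤ 1 + ((1 + 2048 * S) + 23 * T * S * (1 + (1 + 2048 * S))) := by
    have h1 : (1 + 2048 * S) * V ≤ 1 + 2048 * S := mul_le_of_le_one_right hU0 hV1
    have h2 : 23 * T * S * (1 + (1 + 2048 * S) * V) ≤ 23 * T * S * (1 + (1 + 2048 * S)) :=
      mul_le_mul_of_nonneg_left (by linarith) (by positivity)
    linarith
  have hcΛeq : 4 / cLambda n CP Λ = 8 * (Fintype.card n : ℝ) * (1 + 4 * CP) * (1 + Real.sqrt Λ) ^ 2 := by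
    unfold cLambda
    have h1 : (1 + Real.sqrt Λ) ≠ 0 := by positivity
    have h2 : (2 * (Fintype.card n : ℝ) * (1 + 4 * CP)) ≠ 0 := by positivity
    field_simp
    ring
  have hsq : (Real.sqrt Λ - 1) ^ 2 * (4 * CP) ≤ 1 := by nlinarith [hreg]
  have hsq' : (Real.sqrt Λ - 1) ^ 2 ≤ 1 / (4 * CP) := by rw [le_div_iff₀ (by positivity)]; exact hsq
  have hΛb : (1 + Real.sqrt Λ) ^ 2 ≤ 8 + 1 / (2 * CP) := by
    have e : (1 : ℝ) / (2 * CP) = 2 * (1 / (4 * CP)) := by field_simp; ring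
    rw [e]
    nlinarith [sq_nonneg (Real.sqrt Λ - 3), hsq']
  have hA2 : 4 / cLambda n CP Λ ≤ 8 * (Fintype.card n : ℝ) * (1 + 4 * CP) * (8 + 1 / (2 * CP)) := by
    rw [hcΛeq]
    exact mul_le_mul_of_nonneg_left hΛb (by positivity)
  have hA2pos : 0 ≤ 4 / cLambda n CP Λ := by
    have := cLambda_pos (n := n) (Λ := Λ) hCP.le
    positivity
  have hB : B₀ + X * b + b ^ 2 * Y * G ≤ B₀ + X / 2 + Y * G / 4 := by
    have h1 : X * b ≤ X * (1 / 2) := mul_le_mul_of_nonneg_left hb2 hX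
    have hb4 : b ^ 2 ≤ (1 / 2) ^ 2 := pow_le_pow_left₀ hb hb2 2
    have h2 : b ^ 2 * Y * G ≤ (1 / 2) ^ 2 * Y * G :=
      mul_le_mul_of_nonneg_right (mul_le_mul_of_nonneg_right hb4 hY) hG
    have h3 : b ^ 2 * Y * G = b ^ 2 * (Y * G) := by ring
    nlinarith
  have hBpos : 0 ≤ B₀ + X * b + b ^ 2 * Y * G := by positivity
  have hA : (1 + ((1 + 2048 * S) * V + 23 * T * S * (1 + (1 + 2048 * S) * V))) * (4 / cLambda n CP Λ)
      ≤ (1 + ((1 + 2048 * S) + 23 * T * S * (1 + (1 + 2048 * S)))) * (8 * (Fintype.card n : ℝ) * (1 + 4 * CP) * (8 + 1 / (2 * CP))) :=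
    mul_le_mul hA1 hA2 hA2pos (by positivity)
  exact mul_le_mul hA (mul_le_mul_of_nonneg_left hB hK) (mul_nonneg hK hBpos) (by positivity)

/-- **THE OWNER's k-FREE SLICE CONSTANT IS POSITIVE** (`1 ≤ d`, `0 < c`, `0 ≤ ε, θ`): `CPLine d L c ε θ = c·(16·ALine·KhLine)` with `ALine ≥ 18 + ¼`
and `KhLine ≥ 1` (companion of `NE3.SlicePoincareCoulombN.CPLine_nonneg`). [folklore] -/
theorem CPLine_pos (hd : 1 ≤ d) (L : ℕ) {c ε θ : ℝ} (hc : 0 < c) (hε : 0 ≤ ε) (hθ : 0 ≤ θ) : 0 < CPLine d L c ε θ := by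
  have hd1 : (1 : ℝ) ≤ d := by exact_mod_cast hd
  have hdm : 0 ≤ (d : ℝ) - 1 := by linarith
  have hlr : 0 ≤ lrTop d θ := by unfold NE3SlicePoincareBudgetLine.lrTop; positivity
  have hcf : 0 ≤ cfTop d θ := by
    unfold NE3SlicePoincareBudgetLine.cfTop; have := mul_nonneg hdm hθ; positivity
  have hq : 0 ≤ qTop d θ := by unfold NE3SlicePoincareBudgetLine.qTop; positivity
  have hg : 0 ≤ gTop d c θ := by unfold NE3SlicePoincareBudgetLine.gTop; positivity
  have hbh : 0 ≤ bhTop d L c θ := by unfold NE3SlicePoincareBudgetLine.bhTop; positivity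
  have hA : 0 < ALine d c ε θ := by unfold NE3SlicePoincareBudgetLine.ALine; positivity
  have hK : 0 < KhLine d L c ε θ := by unfold NE3SlicePoincareBudgetLine.KhLine; positivity
  unfold NE3SlicePoincareBudgetLine.CPLine; positivity

/-! ## §2 THE END with its constant displayed, uniform in `(ε, s₁, b, s₂, dom)` (slice constant `CP > 0`) -/

/-- **THE END ON B8's SURFACE OVER `sfClass`, NUMERIC LINES DISCHARGED, ITS CONSTANT DISPLAYED AND FREE OF `(ε, s₁, b, s₂, dom)`** — p410193's
`ne3EnergyRateWCov_sfClass_small_uniform` with the conclusion's constant explicit: for `3 ≤ d`, `2 ≤ L`, `1 ≤ N`, `CP > 0`, `K₀, K₁ ≥ 0` there is `r > 0` such that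
for every `g > 0`, all `0 < ε ≤ r`, `0 ≤ s₁ ≤ r`, `0 ≤ b ≤ ε∕2`, `s₂`, `dom`: `PairLandauGaugeB8Avg` ∧ per-pair `LandauCorrectionSupB8 (K₀, K₁)` ∧ per-pair (P♮) on `slicB8`
⟹ `NE3EnergyRateWCov d (sfClass d L N ε) L N b g C⋆ s₁ s₂ dom`, `C⋆ = C⋆(d, L, card n, CP, g)` the term displayed below (`endLines_exists` +
`ne3EnergyRateWCov_sfClass_towers` + §1 + `NE3EnergyRateWCov.mono`). [folklore] -/
theorem ne3EnergyRateWCov_sfClass_small_const [Nonempty n] {d : ℕ} (hd : 3 ≤ d) {L N : ℕ} [NeZero L] [NeZero N] (hL : 2 ≤ L) (hN : 1 ≤ N)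
    {CP K₀ K₁ : ℝ} (hCP : 0 < CP) (hK₀ : 0 ≤ K₀) (hK₁ : 0 ≤ K₁) :
    ∃ r : ℝ, 0 < r ∧ ∀ ⦃g : ℝ⦄, 0 < g → ∀ ⦃ε s₁ b : ℝ⦄, 0 < ε → ε ≤ r → 0 ≤ s₁ → s₁ ≤ r → 0 ≤ b → b ≤ ε / 2 →
      ∀ (s₂ : ℝ) {dom : _root_.Set (Site d → Fin d → (Matrix n n ℂ)ˣ)},
        PairLandauGaugeB8Avg d (sfClass d L N ε) L N b g s₁ s₂ 1 dom →
        (∀ j : ℕ, ∀ V ∈ dom, ∀ UB : Site d → Fin d → (Matrix n n ℂ)ˣ, IsMinimiser d (sfClass d L N ε) L N (j + 2) V UB → Regular d L N b g (j + 2) UB → ∀ (hWu : IsUnitaryCfg (cavg L UB)) (hx : 0 ≤ ε / ((L : ℝ) ^ (j + 1)) ^ 2) (hs : LevelSmall d L j (ε / ((L : ℝ) ^ (j + 1)) ^ 2)) (hWx : SmallField (cavg L UB) (ε / ((L : ℝ) ^ (j + 1)) ^ 2)) (hθ : cruxC d L * (((L : ℝ) ^ (j + 1)) ^ 2 * (ε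 / ((L : ℝ) ^ (j + 1)) ^ 2)) < 1), LandauCorrectionSupB8 hL j hWu hx hs hWx N hθ K₀ K₁) →
        (∀ j : ℕ, ∀ V ∈ dom, ∀ UB : Site d → Fin d → (Matrix n n ℂ)ˣ, IsMinimiser d (sfClass d L N ε) L N (j + 2) V UB → Regular d L N b g (j + 2) UB → SlicePoincare L (j + 1) (cavg L UB) (slicB8 L N (j + 1) (cavg L UB)) CP (periodBox (N * L ^ (j + 1)))) →
        NE3EnergyRateWCov d (sfClass d L N ε) L N b g
          ((1 + ((1 + 2048 * Real.sqrt (16 * d + 1)) + 23 * Real.sqrt 2 * Real.sqrt (16 * d + 1) * (1 + (1 + 2048 * Real.sqrt (16 * d + 1)))))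
          * (8 * (Fintype.card n : ℝ) * (1 + 4 * CP) * (8 + 1 / (2 * CP)))
          * ((1 + Real.sqrt (192 * ((d : ℝ) * L) * (d + Fintype.card (T4AveragingDeficitWall.Plane d))))
            * (Real.sqrt ((L : ℝ) ^ (d - 2))
              + (Real.sqrt ((L : ℝ) ^ (d - 2)) * Real.sqrt (8 * Fintype.card (T4AveragingDeficitWall.Plane d)) * (128 * (d * (L : ℝ) ^ 2))
                  + 2 * (2048 * ((d : ℝ) + 4) ^ 2 * (L : ℝ) ^ 2 * Real.sqrt (d * (L : ℝ) ^ d))) / 2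
              + (2 * (L : ℝ) ^ (d - 1) + 2 * (8 * d * (L : ℝ) ^ d)) * Real.sqrt (d / (g * (L : ℝ) ^ (d + 2))) / 4)))
          s₁ s₂ dom := by
  obtain ⟨r, hr0, hr⟩ := endLines_exists (n := n) d L N (le_trans (by norm_num) hL) K₀ K₁ hCP.le
  refine ⟨r, hr0, fun g hg ε s₁ b hε hεr hs₁ hs₁r hb hbh s₂ dom hB8 hF5 hP => ?_⟩
  obtain ⟨α₀, P, Q, AN, Ac, ah, Λ, hbε, hε1, hbs, hbε', h1, h2, hθε, hθlε, hPsε, hα, hα3, hα4, hεα, hsmall, hc₃, hK, hS1, hP0, hQ0,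
    hPl, hQl, hAN, hAc, hah, hlines₁, hlineJ, hlineN, hlineα, hlineαN, hρ, hlineΛ, hlineCP, hreg₁, hbudget⟩ :=
    hr hε hεr hs₁ hs₁r hb hbh
  have hEND := ne3EnergyRateWCov_sfClass_towers hd hL hN hb hbε hε1 hg hbs hbε' h1 h2 hθε hθlε hPsε hα hα3 hα4 hεα hs₁ hsmall hc₃ hK hS1
    hP0 hQ0 hPl hQl hK₀ hK₁ hCP.le hAN hAc hah hlines₁ hlineJ hlineN hlineα hlineαN hρ hlineΛ hlineCP hreg₁ hbudget hB8 hF5 hP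
  have hb2 : b ≤ 1 / 2 := by linarith
  refine hEND.mono (endConst_le (n := n) ?_ ?_ ?_ hP0 hs₁ hCP ?_ ?_ ?_ ?_ ?_ hb hb2 hρ hreg₁) le_rfl le_rfl
  all_goals positivity

/-! ## §3 `hF5` traded for N07's interface (H3ˢᵘᵖ) — the constant threaded -/

/-- **THE END WITH THE SUP LETTER GONE, SAME DISPLAYED CONSTANT** — p410193's `ne3EnergyRateWCov_sfClass_small_of_leafH3sup_uniform` over §2 (same proof: the
uniform majorants `K₀*`, `K₁*` are closed terms in `(d, L, N, card n)` and do not enter the constant): `∃ r > 0, ∀ g > 0, ∀` leaf letters `0 ≤ b′, c′` on (Rb) and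
the `c′`-line, `∀ 0 < ε ≤ r, 0 ≤ s₁ ≤ r, 0 ≤ b ≤ ε∕2, ∀ s₂ dom`: `PairLandauGaugeB8Avg d (sfClass d L N ε) L N b g s₁ s₂ 1 dom` ∧ `LeafH3sup d L N ε b′ c′ dom` ∧
per-pair (P♮) on `slicB8` with constant `CP > 0` ⟹ `NE3EnergyRateWCov d (sfClass d L N ε) L N b g C⋆ s₁ s₂ dom`. [folklore] -/
theorem ne3EnergyRateWCov_sfClass_small_of_leafH3sup_const [Nonempty n] (hd : 3 ≤ d) {L N : ℕ} [NeZero L] [NeZero N] (hL : 2 ≤ L)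
    (hN : 1 ≤ N) {CP : ℝ} (hCP : 0 < CP) :
    ∃ r : ℝ, 0 < r ∧ ∀ ⦃g : ℝ⦄, 0 < g → ∀ ⦃b' c' : ℝ⦄, 0 ≤ b' → 0 ≤ c' →
      2 ^ 15 * ((d : ℝ) + 1) ^ 2 * ((d : ℝ) + 4) ^ 2 * (L : ℝ) ^ 2 * b' ≤ 1 →
      23040 * (d : ℝ) ^ 4 * (frameC d L + d) ^ 3 * (c' + curConst d L * b' ^ 2) ≤ 1 → ∀ ⦃ε s₁ b : ℝ⦄, 0 < ε → ε ≤ r → 0 ≤ s₁ → s₁ ≤ r → 0 ≤ b → b ≤ ε / 2 →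
      ∀ (s₂ : ℝ) {dom : _root_.Set (Site d → Fin d → (Matrix n n ℂ)ˣ)},
        PairLandauGaugeB8Avg d (sfClass d L N ε) L N b g s₁ s₂ 1 dom →
        LeafH3sup d L N ε b' c' dom →
        (∀ j : ℕ, ∀ V ∈ dom, ∀ UB : Site d → Fin d → (Matrix n n ℂ)ˣ, IsMinimiser d (sfClass d L N ε) L N (j + 2) V UB → Regular d L N b g (j + 2) UB →
          SlicePoincare L (j + 1) (cavg L UB) (slicB8 L N (j + 1) (cavg L UB)) CP (periodBox (N * L ^ (j + 1)))) →
        NE3EnergyRateWCov d (sfClass d L N ε) L N b g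
          ((1 + ((1 + 2048 * Real.sqrt (16 * d + 1)) + 23 * Real.sqrt 2 * Real.sqrt (16 * d + 1) * (1 + (1 + 2048 * Real.sqrt (16 * d + 1)))))
          * (8 * (Fintype.card n : ℝ) * (1 + 4 * CP) * (8 + 1 / (2 * CP)))
          * ((1 + Real.sqrt (192 * ((d : ℝ) * L) * (d + Fintype.card (T4AveragingDeficitWall.Plane d))))
            * (Real.sqrt ((L : ℝ) ^ (d - 2))
              + (Real.sqrt ((L : ℝ) ^ (d - 2)) * Real.sqrt (8 * Fintype.card (T4AveragingDeficitWall.Plane d)) * (128 * (d * (L : ℝ) ^ 2))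
                  + 2 * (2048 * ((d : ℝ) + 4) ^ 2 * (L : ℝ) ^ 2 * Real.sqrt (d * (L : ℝ) ^ d))) / 2
              + (2 * (L : ℝ) ^ (d - 1) + 2 * (8 * d * (L : ℝ) ^ d)) * Real.sqrt (d / (g * (L : ℝ) ^ (d + 2))) / 4)))
          s₁ s₂ dom := by
  have hd1 : 1 ≤ d := le_trans (by norm_num) hd
  -- the level-free constant and the uniform majorants `K₀*`, `K₁*` of `K₀(ε)`, `K₁(ε)` (p410193 §2 verbatim)
  obtain ⟨cR, hcR⟩ : ∃ K : ℝ, K = 1 + 2 * (Fintype.card n : ℝ) * (64 * (d : ℝ) ^ 2 * N) ^ d + 27 * (Fintype.card n : ℝ) ^ 3 * (512 : ℝ) ^ d * (N : ℝ) ^ d := ⟨_, rfl⟩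
  have hcR0 : 0 ≤ cR := by rw [hcR]; positivity
  have hF0 : 0 ≤ frameC d L + d := le_trans zero_le_one (one_le_frameC_add hd1 L)
  obtain ⟨K₀s, hK₀s⟩ : ∃ K : ℝ, K = 2 * ((d : ℝ) * liftC d * (36 * d * (frameC d L + d) ^ 2) * cR * (6 + 2 * ((d : ℝ) + 1))) := ⟨_, rfl⟩
  obtain ⟨K₁s, hK₁s⟩ : ∃ K : ℝ, K = 2 * ((d : ℝ) * liftC d * (36 * d * (frameC d L + d)) * cR * (6 + 2 * ((d : ℝ) + 1))) := ⟨_, rfl⟩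
  have hK₀ : 0 ≤ K₀s := by rw [hK₀s]; have := liftC_nonneg d; positivity
  have hK₁ : 0 ≤ K₁s := by rw [hK₁s]; have := liftC_nonneg d; positivity
  obtain ⟨r, hr0, hr⟩ := ne3EnergyRateWCov_sfClass_small_const (n := n) hd hL hN (CP := CP) hCP hK₀ hK₁
  have hc := cruxC_nonneg d L
  have hρ0 : 0 < 1 / (2 * cruxC d L + 2) := by positivity
  have hd0 : (0 : ℝ) < d := by exact_mod_cast hd1
  have hF1 : (1 : ℝ) ≤ frameC d L + d := one_le_frameC_add hd1 L
  have hF2 : 0 < 23040 * (d : ℝ) ^ 4 * (frameC d L + d) ^ 2 := by positivity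
  have hσ0 : 0 < 1 / (23040 * (d : ℝ) ^ 4 * (frameC d L + d) ^ 2) := by positivity
  refine ⟨min r (min (1 / (2 * cruxC d L + 2)) (1 / (23040 * (d : ℝ) ^ 4 * (frameC d L + d) ^ 2))), lt_min hr0 (lt_min hρ0 hσ0),
    fun g hg b' c' hb' hc' hRb hcF ε s₁ b hε hεr hs₁ hs₁r hb hbh s₂ dom hB8 h3 hP => ?_⟩
  have hεr' : ε ≤ r := hεr.trans (min_le_left _ _)
  have hs₁r' : s₁ ≤ r := hs₁r.trans (min_le_left _ _)
  obtain ⟨hcε, hε1⟩ := cruxC_eps_le_half d L hε.le (hεr.trans ((min_le_right _ _).trans (min_le_left _ _)))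
  have hεF : 23040 * (d : ℝ) ^ 4 * (frameC d L + d) ^ 2 * ε ≤ 1 := by
    have h1 : ε ≤ 1 / (23040 * (d : ℝ) ^ 4 * (frameC d L + d) ^ 2) := hεr.trans ((min_le_right _ _).trans (min_le_right _ _))
    rw [le_div_iff₀ hF2] at h1; linarith
  -- `K(ε) ≤ K*`
  have hle₀ : (d : ℝ) * liftC d * (6 + 2 * ((d : ℝ) + 1) * ε) * (36 * d * (frameC d L + d) ^ 2)
        * (1 + 2 * (Fintype.card n : ℝ) * (64 * (d : ℝ) ^ 2 * N) ^ d + 27 * (Fintype.card n : ℝ) ^ 3 * (512 : ℝ) ^ d * (N : ℝ) ^ d) / (1 - cruxC d L * ε) ≤ K₀s := by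
    rw [← hcR, hK₀s]
    have hA : 0 ≤ (d : ℝ) * liftC d * (36 * d * (frameC d L + d) ^ 2) * cR := by have := liftC_nonneg d; positivity
    have key := supFacts_const_le d L hA hε.le hε1 hcε
    calc (d : ℝ) * liftC d * (6 + 2 * ((d : ℝ) + 1) * ε) * (36 * d * (frameC d L + d) ^ 2) * cR / (1 - cruxC d L * ε)
        = (d : ℝ) * liftC d * (36 * d * (frameC d L + d) ^ 2) * cR * (6 + 2 * ((d : ℝ) + 1) * ε) / (1 - cruxC d L * ε) := by ring
      _ ≤ 2 * ((d : ℝ) * liftC d * (36 * d * (frameC d L + d) ^ 2) * cR * (6 + 2 * ((d : ℝ) + 1))) := key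
  have hle₁ : (d : ℝ) * liftC d * (6 + 2 * ((d : ℝ) + 1) * ε) * (36 * d * (frameC d L + d))
        * (1 + 2 * (Fintype.card n : ℝ) * (64 * (d : ℝ) ^ 2 * N) ^ d + 27 * (Fintype.card n : ℝ) ^ 3 * (512 : ℝ) ^ d * (N : ℝ) ^ d) / (1 - cruxC d L * ε) ≤ K₁s := by
    rw [← hcR, hK₁s]
    have hA : 0 ≤ (d : ℝ) * liftC d * (36 * d * (frameC d L + d)) * cR := by have := liftC_nonneg d; positivity
    have key := supFacts_const_le d L hA hε.le hε1 hcε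
    calc (d : ℝ) * liftC d * (6 + 2 * ((d : ℝ) + 1) * ε) * (36 * d * (frameC d L + d)) * cR / (1 - cruxC d L * ε)
        = (d : ℝ) * liftC d * (36 * d * (frameC d L + d)) * cR * (6 + 2 * ((d : ℝ) + 1) * ε) / (1 - cruxC d L * ε) := by ring
      _ ≤ 2 * ((d : ℝ) * liftC d * (36 * d * (frameC d L + d)) * cR * (6 + 2 * ((d : ℝ) + 1))) := key
  exact hr hg hε hεr' hs₁ hs₁r' hb hbh s₂ hB8 (hF5_of_leafH3sup hd1 hL h3 hb' hc' hRb hεF hcF hle₀ hle₁) hP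

/-! ## §4 `hP` proved under the owner's four k-free lines (their slice constant is positive) -/

/-- **THE END WITH THE SLICE-POINCARÉ BINDER GONE, `∃ C ≥ 0` RIGHT AFTER `∀ g`** — p410193's `ne3EnergyRateWCov_sfClass_small_of_lines_uniform` (same proof; the
owner's slice constant `CP = 4·card n·(69 + 2δ_W)·CPLine` is POSITIVE, `CPLine_pos`) over §3 (`3 ≤ d`, `2 ≤ L`, `1 ≤ N`; the four k-free lines on `(θ, εc) > 0`). [folklore] -/
theorem ne3EnergyRateWCov_sfClass_small_of_lines_const [Nonempty n] (hd : 3 ≤ d) {L N : ℕ} [NeZero L] [NeZero N] (hL : 2 ≤ L) (hN : 1 ≤ N)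
    {θ εc : ℝ} (hθ : 0 < θ) (hεc : 0 < εc)
    (h1 : ShLine d L (Fintype.card n) εc θ ≤ 1 / 2) (h2 : SmallYLine d L (Fintype.card n) εc θ ≤ 1 / 2)
    (h3 : 68 / 3 * (((d : ℝ) + 1) * ((d : ℝ) + 4)) * C2sq d L * θ ≤ rho d L / 2)
    (h4 : 8 * d * (((d : ℝ) - 1) * θ) ^ 2
      + 2 * ((Fintype.card n : ℝ) * ((4 * (d : ℝ) ^ 2 + 272 * d * (((d : ℝ) + 1) * ((d : ℝ) + 4))) * θ) ^ 2) ≤ 1 / 2) :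
    ∃ r : ℝ, 0 < r ∧ ∀ ⦃g : ℝ⦄, 0 < g → ∃ C : ℝ, 0 ≤ C ∧ ∀ ⦃b' c' : ℝ⦄, 0 ≤ b' → 0 ≤ c' →
      2 ^ 15 * ((d : ℝ) + 1) ^ 2 * ((d : ℝ) + 4) ^ 2 * (L : ℝ) ^ 2 * b' ≤ 1 →
      23040 * (d : ℝ) ^ 4 * (frameC d L + d) ^ 3 * (c' + curConst d L * b' ^ 2) ≤ 1 →
      ∀ ⦃ε s₁ b : ℝ⦄, 0 < ε → ε ≤ r → 0 ≤ s₁ → s₁ ≤ r → 0 ≤ b → b ≤ ε / 2 →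
      ∀ (s₂ : ℝ) {dom : _root_.Set (Site d → Fin d → (Matrix n n ℂ)ˣ)},
        PairLandauGaugeB8Avg d (sfClass d L N ε) L N b g s₁ s₂ 1 dom →
        LeafH3sup d L N ε b' c' dom →
        NE3EnergyRateWCov d (sfClass d L N ε) L N b g C s₁ s₂ dom := by
  have hd1 : 1 ≤ d := by omega
  have hd0 : (0 : ℝ) < d := by exact_mod_cast (show 0 < d by omega)
  have hd1r : (1 : ℝ) ≤ d := by exact_mod_cast hd1
  have hdm : (0 : ℝ) ≤ (d : ℝ) - 1 := by linarith
  have hcard : (0 : ℝ) < (Fintype.card n : ℝ) := by exact_mod_cast Fintype.card_pos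
  -- the k-free slice constant (p410193 §3 verbatim), now with its sign `CP > 0`
  obtain ⟨δW, hδW⟩ : ∃ D : ℝ, D = (2 + 32 * (8 * (Fintype.card n : ℝ) * d * (1 + 2 * (((d : ℝ) - 1) * θ)) ^ 2 * (2 * (8 : ℝ) ^ d) ^ 2))
      * (8 * (Fintype.card n : ℝ) * d * (1 + 2 * (((d : ℝ) - 1) * θ)) ^ 2 * (2 * (8 : ℝ) ^ d) ^ 2) := ⟨_, rfl⟩
  have hδW0 : 0 ≤ δW := by
    rw [hδW]
    have : 0 ≤ 1 + 2 * (((d : ℝ) - 1) * θ) := by have := mul_nonneg hdm hθ.le; linarith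
    positivity
  have hCPL : 0 < CPLine d L (Fintype.card n) εc θ := CPLine_pos hd1 L hcard hεc.le hθ.le
  obtain ⟨CP, hCP⟩ : ∃ C : ℝ, C = 4 * (Fintype.card n : ℝ) * (69 + 2 * δW) * CPLine d L (Fintype.card n) εc θ := ⟨_, rfl⟩
  have hCP0 : 0 < CP := by rw [hCP]; positivity
  obtain ⟨r, hr0, hr⟩ := ne3EnergyRateWCov_sfClass_small_of_leafH3sup_const (n := n) hd hL hN hCP0
  -- the ε-radii of the lines absorbed into `r`
  obtain ⟨A, hA⟩ : ∃ A : ℝ, A = 128 * (69 + 2 * δW) * CPLine d L (Fintype.card n) εc θ * (Fintype.card (Plane d) : ℝ) * (Fintype.card n : ℝ) := ⟨_, rfl⟩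
  have hA0 : 0 ≤ A := by rw [hA]; positivity
  obtain ⟨B₁, hB₁⟩ : ∃ B : ℝ, B = 16 * (14464 * ((d : ℝ) + 1) ^ 2 * ((d : ℝ) + 4) ^ 2) := ⟨_, rfl⟩
  have hB₁0 : 0 < B₁ := by rw [hB₁]; positivity
  obtain ⟨B₂, hB₂⟩ : ∃ B : ℝ, B = 2 * twoLevelSmall d L := ⟨_, rfl⟩
  have hB₂0 : 0 < B₂ := by rw [hB₂]; unfold twoLevelSmall; positivity
  obtain ⟨B₃, hB₃⟩ : ∃ B : ℝ, B = 512 * ((d : ℝ) + 1) * ((d : ℝ) + 4) * (L : ℝ) ^ 2 := ⟨_, rfl⟩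
  have hB₃0 : 0 < B₃ := by rw [hB₃]; positivity
  obtain ⟨B₄, hB₄⟩ : ∃ B : ℝ, B = 226 * (8 * ((d : ℝ) + 1) * ((d : ℝ) + 4)) ^ 2 := ⟨_, rfl⟩
  have hB₄0 : 0 < B₄ := by rw [hB₄]; positivity
  refine ⟨min r (min θ (min (1 / (A + 1)) (min (3 / B₁) (min ((L : ℝ) ^ 2 / B₂) (min (1 / B₃) (2 / B₄)))))),
    lt_min hr0 (lt_min hθ (lt_min (by positivity) (lt_min (by positivity) (lt_min (by positivity) (lt_min (by positivity) (by positivity)))))),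
    fun g hg => ?_⟩
  refine ⟨((1 + ((1 + 2048 * Real.sqrt (16 * d + 1)) + 23 * Real.sqrt 2 * Real.sqrt (16 * d + 1) * (1 + (1 + 2048 * Real.sqrt (16 * d + 1)))))
          * (8 * (Fintype.card n : ℝ) * (1 + 4 * CP) * (8 + 1 / (2 * CP)))
          * ((1 + Real.sqrt (192 * ((d : ℝ) * L) * (d + Fintype.card (T4AveragingDeficitWall.Plane d))))
            * (Real.sqrt ((L : ℝ) ^ (d - 2))
              + (Real.sqrt ((L : ℝ) ^ (d - 2)) * Real.sqrt (8 * Fintype.card (T4AveragingDeficitWall.Plane d)) * (128 * (d * (L : ℝ) ^ 2))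
                  + 2 * (2048 * ((d : ℝ) + 4) ^ 2 * (L : ℝ) ^ 2 * Real.sqrt (d * (L : ℝ) ^ d))) / 2
              + (2 * (L : ℝ) ^ (d - 1) + 2 * (8 * d * (L : ℝ) ^ d)) * Real.sqrt (d / (g * (L : ℝ) ^ (d + 2))) / 4))),
    ?_, fun b' c' hb' hc' hRb hcF ε s₁ b hε hεr hs₁ hs₁r hb hbh s₂ dom hB8 h3L => ?_⟩
  · have := hCP0.le; positivity
  have hεr' : ε ≤ r := hεr.trans (min_le_left _ _)
  have hεθ : ε ≤ θ := hεr.trans ((min_le_right _ _).trans (min_le_left _ _))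
  have hεA : ε ≤ 1 / (A + 1) := hεr.trans ((min_le_right _ _).trans ((min_le_right _ _).trans (min_le_left _ _)))
  have hε1 : ε ≤ 3 / B₁ := hεr.trans ((min_le_right _ _).trans ((min_le_right _ _).trans ((min_le_right _ _).trans (min_le_left _ _))))
  have hε2 : ε ≤ (L : ℝ) ^ 2 / B₂ :=
    hεr.trans ((min_le_right _ _).trans ((min_le_right _ _).trans ((min_le_right _ _).trans ((min_le_right _ _).trans (min_le_left _ _)))))
  have hε3 : ε ≤ 1 / B₃ :=
    hεr.trans ((min_le_right _ _).trans ((min_le_right _ _).trans ((min_le_right _ _).trans ((min_le_right _ _).trans ((min_le_right _ _).trans (min_le_left _ _))))))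
  have hε4 : ε ≤ 2 / B₄ :=
    hεr.trans ((min_le_right _ _).trans ((min_le_right _ _).trans ((min_le_right _ _).trans ((min_le_right _ _).trans ((min_le_right _ _).trans (min_le_right _ _))))))
  have hs₁r' : s₁ ≤ r := hs₁r.trans (min_le_left _ _)
  -- the lines at this `ε`
  have hf1 : 16 * (14464 * ((d : ℝ) + 1) ^ 2 * ((d : ℝ) + 4) ^ 2) * ε ≤ 3 := by
    rw [← hB₁]; rw [le_div_iff₀ hB₁0] at hε1; linarith
  have hf2 : 2 * twoLevelSmall d L * ε ≤ (L : ℝ) ^ 2 := by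
    rw [← hB₂]; rw [le_div_iff₀ hB₂0] at hε2; linarith
  have hbs : 512 * (d + 1) * (d + 4) * (L : ℝ) ^ 2 * b ≤ 1 := by
    have h1' : B₃ * ε ≤ 1 := by rw [le_div_iff₀ hB₃0] at hε3; linarith
    have : B₃ * b ≤ B₃ * ε := mul_le_mul_of_nonneg_left (by linarith) hB₃0.le
    rw [hB₃] at this h1'
    linarith
  have hbε' : b + 226 * (8 * (d + 1) * (d + 4)) ^ 2 * b ^ 2 ≤ ε := by
    have hB4ε : B₄ * ε ≤ 2 := by rw [le_div_iff₀ hB₄0] at hε4; linarith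
    have hb2 : b ^ 2 ≤ (ε / 2) ^ 2 := pow_le_pow_left₀ hb hbh 2
    have : B₄ * b ^ 2 ≤ ε / 2 := by
      calc B₄ * b ^ 2 ≤ B₄ * (ε / 2) ^ 2 := mul_le_mul_of_nonneg_left hb2 hB₄0.le
        _ = (B₄ * ε) * ε / 4 := by ring
        _ ≤ 2 * ε / 4 := by
            have := mul_le_mul_of_nonneg_right hB4ε hε.le
            linarith
        _ = ε / 2 := by ring
    rw [hB₄] at this
    linarith
  have h6 : 128 * (69 + 2 * ((2 + 32 * (8 * (Fintype.card n : ℝ) * d * (1 + 2 * (((d : ℝ) - 1) * θ)) ^ 2 * (2 * (8 : ℝ) ^ d) ^ 2))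
              * (8 * (Fintype.card n : ℝ) * d * (1 + 2 * (((d : ℝ) - 1) * θ)) ^ 2 * (2 * (8 : ℝ) ^ d) ^ 2)))
        * CPLine d L (Fintype.card n) εc θ * (Fintype.card (Plane d) : ℝ) * (Fintype.card n : ℝ) * ε ^ 2 ≤ 1 := by
    rw [← hδW, ← hA]
    have hA1 : 0 < A + 1 := by linarith
    have hεA' : ε * (A + 1) ≤ 1 := by rwa [le_div_iff₀ hA1] at hεA
    have hε1' : ε ≤ 1 := by
      have : ε ≤ ε * (A + 1) := le_mul_of_one_le_right hε.le (by linarith)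
      linarith
    have t1 : A * ε * ε ≤ A * ε * 1 := mul_le_mul_of_nonneg_left hε1' (by positivity)
    have t2 : A * ε ≤ ε * (A + 1) := by linarith [hε.le]
    calc A * ε ^ 2 = A * ε * ε := by ring
      _ ≤ A * ε * 1 := t1
      _ = A * ε := by ring
      _ ≤ ε * (A + 1) := t2
      _ ≤ 1 := hεA'
  refine hr hg hb' hc' hRb hcF hε hεr' hs₁ hs₁r' hb hbh s₂ hB8 h3L ?_
  intro j V _ UB _ hreg
  have hP := slicePoincare_slicB8_cavg_of_regular hd hL hN hb hε hεθ hεc hbs hbε' hf1 hf2 h1 h2 h3 h4 h6 j hreg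
  rw [← hδW, ← hCP] at hP
  exact hP

/-! ## §5 The `d = 4` instance: N16's CONSTANT OF RECORD -/

/-- **N16 · THE CONSTANT OF RECORD** (`d = 4`; `L ≥ 2`, `N ≥ 1`): there is `r > 0` depending on `(L, N, n)` ONLY such that for every regularity letter `g > 0`
there is ONE constant `C ≥ 0` depending on `(L, N, n, g)` ONLY such that for all leaf letters `0 ≤ b′, c′` on (Rb) `2¹⁵·5²·8²·L²·b′ ≤ 1` and the `c′`-line
`23040·4⁴·(frameC 4 L + 4)³·(c′ + curConst·b′²) ≤ 1`, every class radius `0 < ε ≤ r`, B8 constant `0 ≤ s₁ ≤ r`, regularity `0 ≤ b ≤ ε∕2`, every `s₂` and every `dom`: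
`PairLandauGaugeB8Avg 4 (sfClass 4 L N ε) L N b g s₁ s₂ 1 dom` (N05) and `LeafH3sup 4 L N ε b′ c′ dom` (N07) imply `NE3EnergyRateWCov 4 (sfClass 4 L N ε) L N b g C s₁ s₂ dom`
(= `YMDAG.N16 L N ε b g C s₁ s₂ dom`) — §4 with `(θ, εc)` from `ownerLines_exist`; p410193's `n16_of_inEdges_uniform` but for the position of `∃ C` (there: last).
What the instancer of K4's `NE3Carriers.C` may pin: any upper bound of this `C` (`NE3EnergyRateWCov.mono`).  N16 ∕ NE3 NOT proved: the two interfaces are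
the hypotheses. [folklore] -/
theorem n16_constant_of_record [Nonempty n] {L N : ℕ} (hL : 2 ≤ L) (hN : 1 ≤ N) :
    ∃ r : ℝ, 0 < r ∧ ∀ ⦃g : ℝ⦄, 0 < g → ∃ C : ℝ, 0 ≤ C ∧ ∀ ⦃b' c' : ℝ⦄, 0 ≤ b' → 0 ≤ c' →
      2 ^ 15 * ((4 : ℝ) + 1) ^ 2 * ((4 : ℝ) + 4) ^ 2 * (L : ℝ) ^ 2 * b' ≤ 1 →
      23040 * (4 : ℝ) ^ 4 * (frameC 4 L + 4) ^ 3 * (c' + curConst 4 L * b' ^ 2) ≤ 1 →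
      ∀ ⦃ε s₁ b : ℝ⦄, 0 < ε → ε ≤ r → 0 ≤ s₁ → s₁ ≤ r → 0 ≤ b → b ≤ ε / 2 →
      ∀ (s₂ : ℝ) {dom : _root_.Set (Site 4 → Fin 4 → (Matrix n n ℂ)ˣ)},
        PairLandauGaugeB8Avg 4 (sfClass 4 L N ε) L N b g s₁ s₂ 1 dom →
        LeafH3sup 4 L N ε b' c' dom →
        NE3EnergyRateWCov 4 (sfClass 4 L N ε) L N b g C s₁ s₂ dom := by
  haveI : NeZero L := NeZero.of_pos (by omega)
  haveI : NeZero N := NeZero.of_pos (by omega)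
  obtain ⟨θ, εc, hθ, hεc, h1, h2, h3, h4⟩ := ownerLines_exist 4 (L := L) (by omega) (c := (Fintype.card n : ℝ)) (by positivity)
  obtain ⟨r, hr0, hr⟩ := ne3EnergyRateWCov_sfClass_small_of_lines_const (d := 4) (n := n) (by norm_num) hL hN hθ hεc h1 h2 h3 h4
  refine ⟨r, hr0, fun g hg => ?_⟩
  obtain ⟨C, hC0, hC⟩ := hr hg
  refine ⟨C, hC0, fun b' c' hb' hc' hRb hcF => ?_⟩
  exact hC hb' hc' (by simpa only [Nat.cast_ofNat] using hRb) (by simpa only [Nat.cast_ofNat] using hcF)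

end
end Summit.QuantumFields.YangMills.BalabanUVNodes.N16
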